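import Literature.Analysis.FluidPDE.FluidComputer.TaylorGreenCurvature
import HarnessLib

/-!
# Ohkitani's two-parameter Taylor–Green family: `Z̈_S(0) = (5/64)(A² + AB + B²)²` for the truncated system

HONEST FRAMING (cell `pub-fluidc`, verbatim): *low prior, high value-of-information experiment on Tao's
machine paradigm; NOT a claim that NS blows up.* Nothing here concerns the Navier–Stokes PDE beyond the
Galerkin-truncated ODE system both engines of the cell integrate.

Ohkitani's one-shell family `u = (A cos x sin y sin z, B sin x cos y sin z, C sin x sin y cos z)`,
`A + B + C = 0` [cite: Ohkitani2001ODEEnstrophy, eq. (22)] (Taylor–Green is `B = -A`) has printed exact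
short-time enstrophy derivatives in `ξ = t²` [cite: Ohkitani2001ODEEnstrophy, Appendix (A1)–(A2)]:
`Q(0) = c₁(A² + AB + B²)`, `dQ/dξ(0) = c₂(A² + AB + B²)²`, `c₁ = 3/8`, `c₂ = 5/128` (the combination
`A²B²(A+B)²` enters only from `d²Q/dξ²` on). THIS FILE proves both lines for the truncated system. The datum
is entered translated by `(π/2, π/2, π/2)` (purely imaginary coefficients; the enstrophy series is translation
invariant): `fam A B` has coefficients `(i/8)(A k₀, B k₁, C k₂)` on the eight modes `(±1,±1,±1)`, and
`fam 1 (-1) = -tg` (`fam_one_neg_one`). For every real `A, B` and every mode set `S` containing the eight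
modes and the twelve face-diagonal modes `(±2,±2,0), (±2,0,±2), (0,±2,±2)` (`shell8`):
`truncEnstrophy_fam` (`Z_S = (3/8)(A² + AB + B²)`), `advection_fam_of_mem_cube` (closed form `advFam` of the
truncated advection term on `{0,±2}³`: pure gradients `(i/16)k_j c_j²` on the axis modes, `-(i/32)c_m k_j c_j`
on the face diagonals with `k_m = 0`, zero on `|k|² = 12`), `curvatureQ_fam` (`Q_S = (5/64)(A² + AB + B²)²`,
per-mode terms `(5/512)(A−B)²C²`, `(5/512)(A−C)²B²`, `(5/512)(B−C)²A²`), and along any unforced Galerkin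
solution from `fam A B`: **`Z̈_S(0) = (5/64)(A² + AB + B²)² + (27/2)ν²(A² + AB + B²)`**
(`hasDerivAt_deriv_truncEnstrophy_fam`; no `A²B²(A+B)²` term at this order, exactly as printed) and, for
truncated Euler, **`Z̈_S(0) = (5/9)·Z_S(0)²` for every member** (`deriv2_truncEnstrophy_fam_euler`). The cell's
exact jet reproduces the printed family constants through `t⁸` on two members (HOME/BENCHMARKS gen-21
supplement 2); this file makes the `t²` line a theorem for all members. 0 sorry, 0 named facts (D-0026).
-/

noncomputable section

namespace Summit.NavierStokesRegularity.FluidComputer.TaylorGreenFamily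

open Literature.Analysis.FluidPDE.FluidComputer
open Literature.Analysis.FluidPDE.FluidComputer.ShellTransfer
open Literature.Analysis.FluidPDE.FluidComputer.ShellTransfer.TaylorGreenHat
open Complex

/-! ## The datum -/

/-- The coefficient vector `c = (A, B, C)`, `C = -(A+B)`. [cite: Ohkitani2001ODEEnstrophy, eq. (22)] -/
def cvec (A B : ℝ) : Fin 3 → ℝ := ![A, B, -(A + B)]

/-- [folklore] -/ @[simp] theorem cvec_zero (A B : ℝ) : cvec A B 0 = A := rfl
/-- [folklore] -/ @[simp] theorem cvec_one (A B : ℝ) : cvec A B 1 = B := rfl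
/-- [folklore] -/ @[simp] theorem cvec_two (A B : ℝ) : cvec A B 2 = -(A + B) := rfl

/-- The Fourier coefficients of the (translated) family member: `(i/8) c_j k_j` on the eight modes,
`0` elsewhere. [cite: Ohkitani2001ODEEnstrophy, eq. (22)] -/
def coeffFun (A B : ℝ) (k : Fin 3 → ℤ) (j : Fin 3) : ℂ :=
  if k ∈ modes then I * ((cvec A B j : ℝ) : ℂ) * ((k j : ℤ) : ℂ) / 8 else 0

/-- **The family member `(A, B, -(A+B))` as a `FourierVelocity`** (real, divergence-free because
`A + B + C = 0` and `k_j² = 1` on the modes). [cite: Ohkitani2001ODEEnstrophy, eq. (22)] -/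
def fam (A B : ℝ) : FourierVelocity where
  coeff := coeffFun A B
  reality k i := by
    unfold coeffFun
    by_cases hk : k ∈ modes
    · rw [if_pos (neg_mem_modes hk), if_pos hk]
      simp [Pi.neg_apply, map_mul, map_div₀, Complex.conj_I, Complex.conj_ofReal, map_intCast, map_ofNat]
    · have hnk : -k ∉ modes := fun h => hk (by simpa using neg_mem_modes h)
      rw [if_neg hnk, if_neg hk, map_zero]
  divFree k := by
    unfold coeffFun
    by_cases hk : k ∈ modes
    · obtain ⟨h0, h1, h2⟩ := mem_modes.mp hk
      have e0 := sq_eq_one_of_mem_pmOne h0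
      have e1 := sq_eq_one_of_mem_pmOne h1
      have e2 := sq_eq_one_of_mem_pmOne h2
      simp only [if_pos hk, Fin.sum_univ_three, cvec_zero, cvec_one, cvec_two]
      push_cast
      linear_combination (I * (A : ℂ) / 8) * e0 + (I * (B : ℂ) / 8) * e1 + (I * (-((A : ℂ) + B)) / 8) * e2
    · simp [if_neg hk]

/-- The coefficients as a single `if`. [folklore] -/
theorem coeff_eq_ite (A B : ℝ) (q : Fin 3 → ℤ) (j : Fin 3) :
    (fam A B).coeff q j = if q ∈ modes then I * ((cvec A B j : ℝ) : ℂ) * ((q j : ℤ) : ℂ) / 8 else 0 := rfl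

/-- On a carried mode. [folklore] -/
theorem coeff_of_mem (A B : ℝ) {k : Fin 3 → ℤ} (hk : k ∈ modes) (j : Fin 3) :
    (fam A B).coeff k j = I * ((cvec A B j : ℝ) : ℂ) * ((k j : ℤ) : ℂ) / 8 := by
  rw [coeff_eq_ite, if_pos hk]

/-- Off the modes. [folklore] -/
theorem coeff_of_not_mem (A B : ℝ) {k : Fin 3 → ℤ} (hk : k ∉ modes) : (fam A B).coeff k = 0 := by
  funext j
  rw [coeff_eq_ite, if_neg hk]
  rfl

/-- `fam 1 (-1) = -tg`: the Taylor–Green member (up to the sign that the translation by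
`(π/2, π/2, π/2)` produces). [folklore] -/
theorem fam_one_neg_one : fam 1 (-1) = scale (-1) tg := by
  refine fourierVelocity_ext ?_
  funext k j
  rw [scale_coeff, coeff_eq_ite, TaylorGreenHat.coeff_eq_ite]
  by_cases hk : k ∈ modes
  · rw [if_pos hk, if_pos hk]
    fin_cases j <;> simp <;> ring
  · rw [if_neg hk, if_neg hk]
    simp

/-! ## Single shell, energy and enstrophy: (A1) line 1 -/

/-- Every carried mode has `|k|² = 3`. [folklore] -/
theorem fam_isSingleShell (A B : ℝ) : IsSingleShell (fam A B) 3 := by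
  intro k hk
  by_cases hm : k ∈ modes
  · obtain ⟨h0, h1, h2⟩ := mem_modes.mp hm
    unfold knormSq
    rw [Fin.sum_univ_three, sq_eq_one_of_mem_pmOne_real h0, sq_eq_one_of_mem_pmOne_real h1,
      sq_eq_one_of_mem_pmOne_real h2]
    norm_num
  · exact absurd (coeff_of_not_mem A B hm) hk

/-- Each carried mode holds energy `(A² + B² + C²)/128 = (A² + AB + B²)/64`. [folklore] -/
theorem modalEnergy_of_mem (A B : ℝ) {k : Fin 3 → ℤ} (hk : k ∈ modes) :
    modalEnergy (fam A B) k = (A ^ 2 + A * B + B ^ 2) / 64 := by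
  obtain ⟨h0, h1, h2⟩ := mem_modes.mp hk
  have e0 := sq_eq_one_of_mem_pmOne_real h0
  have e1 := sq_eq_one_of_mem_pmOne_real h1
  have e2 := sq_eq_one_of_mem_pmOne_real h2
  unfold modalEnergy
  simp only [Fin.sum_univ_three, coeff_of_mem A B hk, cvec_zero, cvec_one, cvec_two, Complex.normSq_mul,
    Complex.normSq_div, Complex.normSq_I, Complex.normSq_ofReal, Complex.normSq_intCast]
  have : Complex.normSq (8 : ℂ) = 64 := by rw [Complex.normSq_apply]; norm_num
  rw [this]
  nlinarith [e0, e1, e2]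

/-- `E_S(fam A B) = (A² + AB + B²)/8` on any mode set containing the eight modes. [folklore] -/
theorem truncEnergy_fam {S : Finset (Fin 3 → ℤ)} (hS : modes ⊆ S) (A B : ℝ) :
    truncEnergy (fam A B) S = (A ^ 2 + A * B + B ^ 2) / 8 := by
  unfold truncEnergy
  rw [← Finset.sum_subset hS fun k _ hk => modalEnergy_eq_zero_of_coeff (fam A B) (coeff_of_not_mem A B hk)]
  rw [Finset.sum_congr rfl fun k hk => modalEnergy_of_mem A B hk, Finset.sum_const, nsmul_eq_mul]
  have hcard : modes.card = 8 := by
    unfold modes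
    rw [Finset.card_image_of_injective _ vec3_injective]
    decide
  rw [hcard]
  ring

/-- **(A1), line 1: `Z_S(fam A B) = (3/8)(A² + AB + B²)`** on any mode set containing the eight modes.
[cite: Ohkitani2001ODEEnstrophy, Appendix (A1)–(A2), `c₁ = 3/8`] -/
theorem truncEnstrophy_fam {S : Finset (Fin 3 → ℤ)} (hS : modes ⊆ S) (A B : ℝ) :
    truncEnstrophy (fam A B) S = 3 / 8 * (A ^ 2 + A * B + B ^ 2) := by
  rw [truncEnstrophy_eq_of_singleShell (fam A B) S (fam_isSingleShell A B), truncEnergy_fam hS]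
  ring

/-! ## The truncated advection term in closed form -/

/-- The truncated advection term of `fam A B` on any mode set containing the eight modes is the 8-term
sum over the giving modes. [folklore] -/
theorem advection_fam_eq (A B : ℝ) {S : Finset (Fin 3 → ℤ)} (hS : modes ⊆ S) (k : Fin 3 → ℤ)
    (j : Fin 3) :
    advection (fam A B) S k j = -I * ∑ a ∈ pmOne, ∑ b ∈ pmOne, ∑ c ∈ pmOne,
      kdot k ((fam A B).coeff (k - ![a, b, c])) *
        (I * ((cvec A B j : ℝ) : ℂ) * (((![a, b, c] : Fin 3 → ℤ) j : ℤ) : ℂ) / 8) := by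
  unfold advection
  congr 1
  rw [← Finset.sum_subset hS (fun p _ hp => by rw [coeff_of_not_mem A B hp]; simp)]
  rw [sum_modes]
  refine Finset.sum_congr rfl fun a ha => Finset.sum_congr rfl fun b hb =>
    Finset.sum_congr rfl fun c hc => ?_
  rw [coeff_of_mem A B (vec_mem_modes ha hb hc)]

/-- Off the cube `{0,±2}³` the truncated advection term vanishes. [folklore] -/
theorem advection_fam_eq_zero_of_not_mem_cube (A B : ℝ) {S : Finset (Fin 3 → ℤ)} (hS : modes ⊆ S)
    {k : Fin 3 → ℤ} (hk : k ∉ cube) : advection (fam A B) S k = 0 := by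
  funext j
  rw [advection_fam_eq A B hS]
  have hz : ∀ a ∈ pmOne, ∀ b ∈ pmOne, ∀ c ∈ pmOne,
      kdot k ((fam A B).coeff (k - ![a, b, c])) *
        (I * ((cvec A B j : ℝ) : ℂ) * (((![a, b, c] : Fin 3 → ℤ) j : ℤ) : ℂ) / 8) = 0 := by
    intro a ha b hb c hc
    have hq : k - ![a, b, c] ∉ modes := fun hq => hk (mem_cube_of_mediator (vec_mem_modes ha hb hc) hq)
    rw [coeff_of_not_mem A B hq]
    unfold kdot
    simp
  rw [Finset.sum_congr rfl fun a ha => Finset.sum_congr rfl fun b hb =>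
    Finset.sum_congr rfl fun c hc => hz a ha b hb c hc]
  simp

/-- **The truncated advection term of the family in closed form** on the cube: for component `j`,
zero if `k_j = 0`; on the axis mode `k = k_j e_j` the pure gradient `(i/16) k_j c_j²`; on a face diagonal
with the single vanishing entry `k_m = 0` the value `-(i/32) c_m k_j c_j`; zero on `|k|² = 12`.
[folklore] -/
def advFam (A B : ℝ) (k : Fin 3 → ℤ) : Fin 3 → ℂ :=
  ![if k 0 = 0 then 0 else
      if k 1 = 0 ∧ k 2 = 0 then I * ((k 0 : ℤ) : ℂ) * (A : ℂ) ^ 2 / 16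
      else if k 1 = 0 then -I * (B : ℂ) * ((k 0 : ℤ) : ℂ) * (A : ℂ) / 32
      else if k 2 = 0 then -I * (-((A : ℂ) + B)) * ((k 0 : ℤ) : ℂ) * (A : ℂ) / 32
      else 0,
    if k 1 = 0 then 0 else
      if k 0 = 0 ∧ k 2 = 0 then I * ((k 1 : ℤ) : ℂ) * (B : ℂ) ^ 2 / 16
      else if k 0 = 0 then -I * (A : ℂ) * ((k 1 : ℤ) : ℂ) * (B : ℂ) / 32
      else if k 2 = 0 then -I * (-((A : ℂ) + B)) * ((k 1 : ℤ) : ℂ) * (B : ℂ) / 32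
      else 0,
    if k 2 = 0 then 0 else
      if k 0 = 0 ∧ k 1 = 0 then I * ((k 2 : ℤ) : ℂ) * (-((A : ℂ) + B)) ^ 2 / 16
      else if k 0 = 0 then -I * (A : ℂ) * ((k 2 : ℤ) : ℂ) * (-((A : ℂ) + B)) / 32
      else if k 1 = 0 then -I * (B : ℂ) * ((k 2 : ℤ) : ℂ) * (-((A : ℂ) + B)) / 32
      else 0]

set_option maxHeartbeats 8000000 in
/-- The 27 evaluations: on the cube `N_S(fam A B)(k) = advFam A B k`. [folklore] -/
theorem advection_fam_vec (A B : ℝ) {S : Finset (Fin 3 → ℤ)} (hS : modes ⊆ S) {a b c : ℤ}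
    (ha : a ∈ zpmTwo) (hb : b ∈ zpmTwo) (hc : c ∈ zpmTwo) :
    advection (fam A B) S ![a, b, c] = advFam A B ![a, b, c] := by
  rcases mem_zpmTwo.mp ha with rfl | rfl | rfl <;> rcases mem_zpmTwo.mp hb with rfl | rfl | rfl <;>
    rcases mem_zpmTwo.mp hc with rfl | rfl | rfl
  all_goals
    funext j
    fin_cases j
    all_goals
      norm_num [advection_fam_eq A B hS, advFam, sum_pmOne, kdot, Fin.sum_univ_three, coeff_eq_ite,
        mem_modes, mem_pmOne, Pi.sub_apply, Matrix.cons_val_zero, Matrix.cons_val_one, Matrix.head_cons,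
        Matrix.cons_val_two, Matrix.tail_cons, cvec, Complex.ext_iff, pow_two, Complex.add_re,
        Complex.add_im, Complex.sub_re, Complex.sub_im, Complex.mul_re, Complex.mul_im, Complex.neg_re,
        Complex.neg_im, Complex.ofReal_re, Complex.ofReal_im, Complex.I_re, Complex.I_im]
      try (constructor <;> ring)
      try ring

/-- `N_S(fam A B)(k) = advFam A B k` for every `k` in the cube. [folklore] -/
theorem advection_fam_of_mem_cube (A B : ℝ) {S : Finset (Fin 3 → ℤ)} (hS : modes ⊆ S)
    {k : Fin 3 → ℤ} (hk : k ∈ cube) : advection (fam A B) S k = advFam A B k := by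
  obtain ⟨h0, h1, h2⟩ := mem_cube.mp hk
  rw [← vec3_eta k]
  exact advection_fam_vec A B hS h0 h1 h2

/-! ## The twelve face-diagonal modes and the curvature functional: (A1) line 2 -/

/-- **The twelve modes of the shell `|k|² = 8`** in the cube: `(±2,±2,0) ∪ (±2,0,±2) ∪ (0,±2,±2)`.
[folklore] -/
def shell8 : Finset (Fin 3 → ℤ) :=
  KidaPelzHat.box pmTwo pmTwo {0} ∪ (KidaPelzHat.box pmTwo {0} pmTwo ∪ KidaPelzHat.box {0} pmTwo pmTwo)

/-- Membership is entrywise. [folklore] -/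
theorem mem_shell8 {k : Fin 3 → ℤ} : k ∈ shell8 ↔
    (k 0 ∈ pmTwo ∧ k 1 ∈ pmTwo ∧ k 2 = 0) ∨ ((k 0 ∈ pmTwo ∧ k 1 = 0 ∧ k 2 ∈ pmTwo) ∨
      (k 0 = 0 ∧ k 1 ∈ pmTwo ∧ k 2 ∈ pmTwo)) := by
  unfold shell8
  rw [Finset.mem_union, Finset.mem_union, KidaPelzHat.mem_box, KidaPelzHat.mem_box, KidaPelzHat.mem_box,
    Finset.mem_singleton, Finset.mem_singleton, Finset.mem_singleton]

/-- The shell lies in the cube. [folklore] -/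
theorem shell8_subset_cube : shell8 ⊆ cube := by
  intro k hk
  rw [mem_cube]
  rcases mem_shell8.mp hk with ⟨h0, h1, h2⟩ | ⟨h0, h1, h2⟩ | ⟨h0, h1, h2⟩
  · exact ⟨mem_zpmTwo_of_mem_pmTwo h0, mem_zpmTwo_of_mem_pmTwo h1, h2 ▸ zero_mem_zpmTwo⟩
  · exact ⟨mem_zpmTwo_of_mem_pmTwo h0, h1 ▸ zero_mem_zpmTwo, mem_zpmTwo_of_mem_pmTwo h2⟩
  · exact ⟨h0 ▸ zero_mem_zpmTwo, mem_zpmTwo_of_mem_pmTwo h1, mem_zpmTwo_of_mem_pmTwo h2⟩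

/-- **The per-mode curvature terms of the family**: `(5/512)(A−B)²C²` on `(±2,±2,0)`,
`(5/512)(A−C)²B²` on `(±2,0,±2)`, `(5/512)(B−C)²A²` on `(0,±2,±2)` (`C = -(A+B)`), zero elsewhere.
[folklore] -/
def famTerm (A B : ℝ) (k : Fin 3 → ℤ) : ℝ :=
  if k ∈ shell8 then
    (if k 2 = 0 then 5 / 512 * (A - B) ^ 2 * (A + B) ^ 2
     else if k 1 = 0 then 5 / 512 * (2 * A + B) ^ 2 * B ^ 2
     else 5 / 512 * (A + 2 * B) ^ 2 * A ^ 2)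
  else 0

set_option maxHeartbeats 8000000 in
/-- The 27 per-mode curvature terms `(|k|² - 3)|P_k N̂(k)|² = famTerm A B k` on the cube. [folklore] -/
theorem curvatureTerm_vec (A B : ℝ) {a b c : ℤ} (ha : a ∈ zpmTwo) (hb : b ∈ zpmTwo) (hc : c ∈ zpmTwo) :
    (knormSq ![a, b, c] - 3) * ∑ j, Complex.normSq (leray ![a, b, c] (advFam A B ![a, b, c]) j) =
      famTerm A B ![a, b, c] := by
  rcases mem_zpmTwo.mp ha with rfl | rfl | rfl <;> rcases mem_zpmTwo.mp hb with rfl | rfl | rfl <;>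
    rcases mem_zpmTwo.mp hc with rfl | rfl | rfl
  all_goals
    norm_num [advFam, famTerm, leray_apply, kdot, knormSq, Fin.sum_univ_three, mem_shell8, mem_pmTwo,
      Matrix.cons_val_zero, Matrix.cons_val_one, Matrix.head_cons, Matrix.cons_val_two, Matrix.tail_cons,
      Complex.normSq_apply, pow_two, Complex.add_re, Complex.add_im, Complex.sub_re, Complex.sub_im,
      Complex.mul_re, Complex.mul_im, Complex.neg_re, Complex.neg_im, Complex.ofReal_re, Complex.ofReal_im,
      Complex.I_re, Complex.I_im, Complex.div_re, Complex.div_im]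
    try ring

/-- Every per-mode term of `Q_S(fam A B)`, for any mode set containing the eight modes. [folklore] -/
theorem curvatureTerm_eq (A B : ℝ) {S : Finset (Fin 3 → ℤ)} (hS : modes ⊆ S) (k : Fin 3 → ℤ) :
    (knormSq k - 3) * ∑ j, Complex.normSq (leray k (advection (fam A B) S k) j) = famTerm A B k := by
  by_cases hk : k ∈ cube
  · rw [advection_fam_of_mem_cube A B hS hk]
    obtain ⟨h0, h1, h2⟩ := mem_cube.mp hk
    rw [← vec3_eta k]
    exact curvatureTerm_vec A B h0 h1 h2
  · rw [advection_fam_eq_zero_of_not_mem_cube A B hS hk, leray_zero]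
    unfold famTerm
    rw [if_neg fun h => hk (shell8_subset_cube h)]
    simp

/-- The three boxes are pairwise disjoint. [folklore] -/
theorem disjoint_boxes₁ :
    Disjoint (KidaPelzHat.box pmTwo pmTwo {0}) (KidaPelzHat.box pmTwo {0} pmTwo ∪ KidaPelzHat.box {0} pmTwo pmTwo) := by
  rw [Finset.disjoint_left]
  intro k h1 h2
  rw [KidaPelzHat.mem_box, Finset.mem_singleton] at h1
  rw [Finset.mem_union, KidaPelzHat.mem_box, KidaPelzHat.mem_box, Finset.mem_singleton,
    Finset.mem_singleton] at h2
  rcases h2 with ⟨-, h, -⟩ | ⟨h, -, -⟩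
  · have := h1.2.1; rw [h, mem_pmTwo] at this; omega
  · have := h1.1; rw [h, mem_pmTwo] at this; omega

/-- [folklore] -/ theorem disjoint_boxes₂ : Disjoint (KidaPelzHat.box pmTwo {0} pmTwo) (KidaPelzHat.box {0} pmTwo pmTwo) := by
  rw [Finset.disjoint_left]
  intro k h1 h2
  rw [KidaPelzHat.mem_box, Finset.mem_singleton] at h1 h2
  have := h1.1; rw [h2.1, mem_pmTwo] at this; omega

/-- Each box has four elements. [folklore] -/
theorem card_box₁ : (KidaPelzHat.box pmTwo pmTwo {0}).card = 4 := by
  unfold KidaPelzHat.box; rw [Finset.card_image_of_injective _ vec3_injective]; decide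

/-- [folklore] -/ theorem card_box₂ : (KidaPelzHat.box pmTwo {0} pmTwo).card = 4 := by
  unfold KidaPelzHat.box; rw [Finset.card_image_of_injective _ vec3_injective]; decide

/-- [folklore] -/ theorem card_box₃ : (KidaPelzHat.box {0} pmTwo pmTwo).card = 4 := by
  unfold KidaPelzHat.box; rw [Finset.card_image_of_injective _ vec3_injective]; decide

/-- `famTerm` on each box. [folklore] -/
theorem famTerm_box₁ (A B : ℝ) {k : Fin 3 → ℤ} (hk : k ∈ KidaPelzHat.box pmTwo pmTwo {0}) :
    famTerm A B k = 5 / 512 * (A - B) ^ 2 * (A + B) ^ 2 := by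
  rw [KidaPelzHat.mem_box, Finset.mem_singleton] at hk
  unfold famTerm
  rw [if_pos (mem_shell8.mpr (Or.inl hk)), if_pos hk.2.2]

/-- [folklore] -/ theorem famTerm_box₂ (A B : ℝ) {k : Fin 3 → ℤ} (hk : k ∈ KidaPelzHat.box pmTwo {0} pmTwo) :
    famTerm A B k = 5 / 512 * (2 * A + B) ^ 2 * B ^ 2 := by
  rw [KidaPelzHat.mem_box, Finset.mem_singleton] at hk
  have h2 : k 2 ≠ 0 := by have := hk.2.2; rw [mem_pmTwo] at this; omega
  unfold famTerm
  rw [if_pos (mem_shell8.mpr (Or.inr (Or.inl hk))), if_neg h2, if_pos hk.2.1]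

/-- [folklore] -/ theorem famTerm_box₃ (A B : ℝ) {k : Fin 3 → ℤ} (hk : k ∈ KidaPelzHat.box {0} pmTwo pmTwo) :
    famTerm A B k = 5 / 512 * (A + 2 * B) ^ 2 * A ^ 2 := by
  rw [KidaPelzHat.mem_box, Finset.mem_singleton] at hk
  have h2 : k 2 ≠ 0 := by have := hk.2.2; rw [mem_pmTwo] at this; omega
  have h1 : k 1 ≠ 0 := by have := hk.2.1; rw [mem_pmTwo] at this; omega
  unfold famTerm
  rw [if_pos (mem_shell8.mpr (Or.inr (Or.inr hk))), if_neg h2, if_neg h1]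

/-- **(A1), line 2 for the truncated system: `Q_S(fam A B) = (5/64)(A² + AB + B²)²`** on every mode set
containing the eight modes and the twelve face-diagonal modes.
[cite: Ohkitani2001ODEEnstrophy, Appendix (A1)–(A2), `c₂ = 5/128`] -/
theorem curvatureQ_fam {S : Finset (Fin 3 → ℤ)} (hS : modes ⊆ S) (h8 : shell8 ⊆ S) (A B : ℝ) :
    curvatureQ (fam A B) S 3 = 5 / 64 * (A ^ 2 + A * B + B ^ 2) ^ 2 := by
  unfold curvatureQ
  rw [Finset.sum_congr rfl fun k _ => curvatureTerm_eq A B hS k]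
  have hzero : ∀ k ∈ S, k ∉ shell8 → famTerm A B k = 0 := by
    intro k _ hk
    unfold famTerm
    rw [if_neg hk]
  rw [← Finset.sum_subset h8 hzero]
  unfold shell8
  rw [Finset.sum_union disjoint_boxes₁, Finset.sum_union disjoint_boxes₂,
    Finset.sum_congr rfl fun k hk => famTerm_box₁ A B hk,
    Finset.sum_congr rfl fun k hk => famTerm_box₂ A B hk,
    Finset.sum_congr rfl fun k hk => famTerm_box₃ A B hk,
    Finset.sum_const, Finset.sum_const, Finset.sum_const, card_box₁, card_box₂, card_box₃]
  simp only [nsmul_eq_mul]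
  push_cast
  ring

/-! ## `Z̈_S(0)` for the whole family -/

/-- **THE ENSTROPHY CURVATURE OF OHKITANI'S FAMILY.** Along any unforced Galerkin solution (any `ν`, any
pressure multiplier) supported in `S ⊇ modes ∪ shell8` and started from `fam A B`:
`Z̈_S(0) = (5/64)(A² + AB + B²)² + (27/2)ν²(A² + AB + B²)`.
[cite: Ohkitani2001ODEEnstrophy, Appendix (A1)–(A2) (inviscid part: `2·c₂·(A²+AB+B²)²`, `c₂ = 5/128`)] -/
theorem hasDerivAt_deriv_truncEnstrophy_fam {U : ℝ → FourierVelocity} {S : Finset (Fin 3 → ℤ)} {ν : ℝ}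
    {c : ℝ → (Fin 3 → ℤ) → ℂ} (hU : IsGalerkinSolution U S ν c fun _ _ _ => 0)
    (hsupp : IsSupportedOn U S) (A B : ℝ) (h0 : U 0 = fam A B) (hS : modes ⊆ S) (h8 : shell8 ⊆ S) :
    HasDerivAt (deriv fun s => truncEnstrophy (U s) S)
      (5 / 64 * (A ^ 2 + A * B + B ^ 2) ^ 2 + 27 / 2 * ν ^ 2 * (A ^ 2 + A * B + B ^ 2)) 0 := by
  have h := hasDerivAt_deriv_truncEnstrophy_singleShell' hU hsupp 0 (lam := 3)
    (by rw [h0]; exact fam_isSingleShell A B)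
  rw [h0, truncEnstrophy_fam hS, curvatureQ_fam hS h8] at h
  convert h using 1
  ring

/-- **Truncated Euler, every member of the family: `Z̈_S(0) = (5/9)·Z_S(0)²`** — the amplitude- AND
shape-free form of (A1) lines 1–2 (`2c₂/c₁² = 5/9`). [cite: Ohkitani2001ODEEnstrophy, Appendix (A1)–(A2)] -/
theorem deriv2_truncEnstrophy_fam_euler {U : ℝ → FourierVelocity} {S : Finset (Fin 3 → ℤ)}
    {c : ℝ → (Fin 3 → ℤ) → ℂ} (hU : IsGalerkinSolution U S 0 c fun _ _ _ => 0)
    (hsupp : IsSupportedOn U S) (A B : ℝ) (h0 : U 0 = fam A B) (hS : modes ⊆ S) (h8 : shell8 ⊆ S) :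
    deriv (deriv fun s => truncEnstrophy (U s) S) 0 = 5 / 9 * truncEnstrophy (U 0) S ^ 2 := by
  rw [(hasDerivAt_deriv_truncEnstrophy_fam hU hsupp A B h0 hS h8).deriv, h0, truncEnstrophy_fam hS]
  ring

end Summit.NavierStokesRegularity.FluidComputer.TaylorGreenFamily

end
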